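import Mathlib
import Literature.NumberTheory.Automorphic.HilbertModularFormQExpansion
import Summits.Langlands.Langlands.Theorems.CapacityClassicalityHilbertIntegralOverconvergentIsCongruenceStubFiniteQIndexAntidiagonal

/-!
# Leading exponents of cone-supported `q`-expansions add under convolution (stub U4 of line Sketch-ideate-r1-k1)

Stub `stub_lead_convolution` (U4) for line Sketch-ideate-r1-k1 of the crux
`HilbertIntegralOverconvergentIsCongruence` (stmt-Langlands-8485).  Section U of the line proves
linear independence of monomials in Hilbert modular forms over a totally real field `F` by LEADING
EXPONENTS: coefficient functions `a, b : F → ℂ` supported on the `q`-expansion cone `qIndexSet F`,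
a real height `lam : F →+ ℝ` (additive, injective), `νa` / `νb` the points of the supports of
minimal height, and `c` the cone convolution `c ν = ∑_{(μ, μ') cone pair, μ + μ' = ν} a μ · b μ'`
(a finite sum by the landed `stub_finite_qIndex_antidiagonal`).  Then `c (νa + νb) = a νa · b νb`
and every `ν` with `c ν ≠ 0` has `lam (νa + νb) ≤ lam ν`.

Proof.  (Second conjunct) if `c ν ≠ 0` some pair `(μ, μ')` of the antidiagonal of `ν` has
`a μ ≠ 0` and `b μ' ≠ 0`, so `lam ν = lam μ + lam μ' ≥ lam νa + lam νb = lam (νa + νb)`.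
(First conjunct) the pair `(νa, νb)` lies on the antidiagonal of `νa + νb`, and every other pair
`(μ, μ')` on it contributes `0`: if `a μ ≠ 0` and `b μ' ≠ 0` then `lam μ ≥ lam νa`,
`lam μ' ≥ lam νb` and `lam μ + lam μ' = lam νa + lam νb` force `lam μ = lam νa`, hence `μ = νa` by
injectivity and then `μ' = νb` by cancellation.
-/

set_option linter.dupNamespace false

noncomputable section

namespace Summit.Langlands.Langlands.Theorems.HilbertIntegralOverconvergentIsCongruence

open NumberField
open Literature.NumberTheory.Automorphic Literature.NumberTheory.Automorphic.HilbertModular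

/-- The antidiagonal `{(μ, μ') : μ, μ' ∈ qIndexSet F, μ + μ' = ν}` of the `q`-expansion cone is
listed by a finite set (from the landed finiteness `stub_finite_qIndex_antidiagonal`). -/
theorem lcv_exists_antidiagonal_finset (F : Type) [Field F] [NumberField F]
    [NumberField.IsTotallyReal F] (ν : F) :
    ∃ T : Finset (F × F), ∀ μ : F × F,
      μ ∈ T ↔ μ.1 ∈ qIndexSet F ∧ μ.2 ∈ qIndexSet F ∧ μ.1 + μ.2 = ν :=
  ⟨(stub_finite_qIndex_antidiagonal F ν).toFinset, fun _ ↦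
    (Set.Finite.mem_toFinset _).trans Iff.rfl⟩

/-- If a pair `(μ, μ')` with `μ + μ' = ν` has `a μ ≠ 0` and `b μ' ≠ 0`, where the supports of `a` and
`b` have `lam`-minimal points `νa` and `νb` for an additive height `lam`, then
`lam (νa + νb) ≤ lam ν`. -/
theorem lcv_height_le_of_pair {F : Type} [Field F] (lam : F →+ ℝ) (a b : F → ℂ) (νa νb : F)
    (hmina : ∀ ν, a ν ≠ 0 → lam νa ≤ lam ν) (hminb : ∀ ν, b ν ≠ 0 → lam νb ≤ lam ν)
    {μ μ' ν : F} (hsum : μ + μ' = ν) (haμ : a μ ≠ 0) (hbμ' : b μ' ≠ 0) :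
    lam (νa + νb) ≤ lam ν := by
  rw [← hsum, map_add, map_add]
  exact add_le_add (hmina μ haμ) (hminb μ' hbμ')

/-- If a pair `(μ, μ')` with `μ + μ' = νa + νb` has `a μ ≠ 0` and `b μ' ≠ 0`, where the supports of
`a` and `b` have `lam`-minimal points `νa` and `νb` for an additive INJECTIVE height `lam`, then
`(μ, μ') = (νa, νb)`: the inequalities `lam νa ≤ lam μ`, `lam νb ≤ lam μ'` and the equality
`lam μ + lam μ' = lam νa + lam νb` force `lam μ = lam νa`. -/
theorem lcv_pair_eq_of_ne_zero {F : Type} [Field F] (lam : F →+ ℝ) (hlam : Function.Injective lam)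
    (a b : F → ℂ) (νa νb : F)
    (hmina : ∀ ν, a ν ≠ 0 → lam νa ≤ lam ν) (hminb : ∀ ν, b ν ≠ 0 → lam νb ≤ lam ν)
    {μ μ' : F} (hsum : μ + μ' = νa + νb) (haμ : a μ ≠ 0) (hbμ' : b μ' ≠ 0) :
    (μ, μ') = (νa, νb) := by
  have h1 : lam νa ≤ lam μ := hmina μ haμ
  have h2 : lam νb ≤ lam μ' := hminb μ' hbμ'
  have h3 : lam μ + lam μ' = lam νa + lam νb := by rw [← map_add, hsum, map_add]
  have h4 : lam μ = lam νa := by linarith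
  have h5 : μ = νa := hlam h4
  subst h5
  exact Prod.ext rfl (add_left_cancel hsum)

/-- **stub U4 — `stub_lead_convolution` (leading exponents add).** `lam : F → ℝ` additive and
injective; `a, b : F → ℂ` supported on the cone `qIndexSet F` with `lam`-minimal support points
`νa`, `νb`; `c` the cone convolution of `a` and `b` (`c ν = ∑_{μ + μ' = ν} a μ b μ'` over pairs of
cone indices, finite by `stub_finite_qIndex_antidiagonal`).  Then `c (νa + νb) = a νa · b νb` (the
only contributing pair is `(νa, νb)`: `lam μ ≥ lam νa`, `lam μ' ≥ lam νb` and
`lam μ + lam μ' = lam νa + lam νb` force equalities, and `lam` is injective) and every `ν` with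
`c ν ≠ 0` has `lam (νa + νb) ≤ lam ν`. [folklore] -/
theorem stub_lead_convolution (F : Type) [Field F] [NumberField F] [NumberField.IsTotallyReal F]
    (lam : F →+ ℝ) (hlam : Function.Injective lam) (a b c : F → ℂ)
    (ha : ∀ ν, a ν ≠ 0 → ν ∈ qIndexSet F) (hb : ∀ ν, b ν ≠ 0 → ν ∈ qIndexSet F)
    (hc : ∀ (ν : F) (T : Finset (F × F)),
      (∀ μ : F × F, μ ∈ T ↔ μ.1 ∈ qIndexSet F ∧ μ.2 ∈ qIndexSet F ∧ μ.1 + μ.2 = ν) →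
      c ν = ∑ μ ∈ T, a μ.1 * b μ.2)
    (νa νb : F) (hνa : a νa ≠ 0) (hνb : b νb ≠ 0)
    (hmina : ∀ ν, a ν ≠ 0 → lam νa ≤ lam ν) (hminb : ∀ ν, b ν ≠ 0 → lam νb ≤ lam ν) :
    c (νa + νb) = a νa * b νb ∧ ∀ ν, c ν ≠ 0 → lam (νa + νb) ≤ lam ν := by
  refine ⟨?_, fun ν hν ↦ ?_⟩
  · -- the leading coefficient: only the pair `(νa, νb)` contributes
    obtain ⟨T, hT⟩ := lcv_exists_antidiagonal_finset F (νa + νb)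
    rw [hc (νa + νb) T hT]
    refine Finset.sum_eq_single (νa, νb) ?_ fun h ↦ absurd ((hT _).2 ⟨ha νa hνa, hb νb hνb, rfl⟩) h
    rintro ⟨μ, μ'⟩ hμT hne
    by_contra h
    obtain ⟨haμ, hbμ'⟩ := mul_ne_zero_iff.1 h
    exact hne (lcv_pair_eq_of_ne_zero lam hlam a b νa νb hmina hminb ((hT _).1 hμT).2.2 haμ hbμ')
  · -- the leading exponent: some pair `(μ, μ')` of the antidiagonal of `ν` contributes
    obtain ⟨T, hT⟩ := lcv_exists_antidiagonal_finset F ν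
    rw [hc ν T hT] at hν
    obtain ⟨μ, hμT, hne⟩ := Finset.exists_ne_zero_of_sum_ne_zero hν
    obtain ⟨haμ, hbμ'⟩ := mul_ne_zero_iff.1 hne
    exact lcv_height_le_of_pair lam a b νa νb hmina hminb ((hT _).1 hμT).2.2 haμ hbμ'

end Summit.Langlands.Langlands.Theorems.HilbertIntegralOverconvergentIsCongruence

end
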